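import Summits.ResolutionOfSingularities.ResolutionOfSingularities.Theorems.WildQuotientsSummitReductionStubPairOrbitNormalFormBlowupModelSing2
import Literature.AlgebraicGeometry.Resolution.BlowupAlgebraStrictTransform
import Literature.AlgebraicGeometry.Resolution.BlowupAlgebraPresentation
import Literature.AlgebraicGeometry.Resolution.NodalBlowupChartAlgebra
import Literature.AlgebraicGeometry.Resolution.EtaleLocalAlgebra
import HarnessLib

/-!
# `WildQuotients.SummitReduction` (stmt-ResolutionOfSingularities-16324), line `FramePerfect`, stub NB1
# (`stub_pair_orbitNormalFormBlowup_modelSingularOverCentre`): blow-up charts of a regular local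
# ring along four members of a regular system of parameters — coefficient-free set-up

Route `ResolutionOfSingularities/WildQuotients`, crux `SummitReduction`; helper file of the line
skeleton (v9), stub NB1 = de Jong 1996, Claim 4.27 [C1] on the coefficient-free model
`A⟦u, v⟧/(uv - ∏_{i<s} tᵢ)` (de Jong 1997, proof of Prop. 5.11: the same normal forms over an
arbitrary regular local base). The chart computation of 4.27 (p. 76) is carried out for an
ARBITRARY regular local ring `R` with a part `z : Fin N → R` of a regular system of parameters
(`IsRsopPart`), a centre `(z ∘ ι)` of four of its members (`ι : Fin 4 → Fin N` injective) and the
affine blowup algebras `R[I/z_{ι i}] ⊆ R[1/z_{ι i}]` (`blowupAlgebra`, image model); the model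
`R = A⟦u, v⟧`, `z = (u, v, t₀, …, t_{m-1})` is plugged in at the end of the chain
(`…ModelSingularOverCentre.lean`). This first file PROVES the set-up:

* `isRsopPart_quotient_cons` — a part `(a, v₁, …, v_n)` of a regular system of parameters
  stays one (`v̄`) modulo its first member (Matsumura 14.2);
* `isRegularRing_chart`, `isDomain_chart`, `prime_algebraMap_centre` — the chart rings are
  regular domains in which the exceptional equation `z_{ι i}` is a prime element
  (Liu 8.1.19 (a) on the charts, `blowupAlgebra.isRegularRing`; Stacks 0BIQ);
* `algebraMap_mem_span_centre_iff`, `not_dvd_algebraMap` — `a ∈ (z_{ι i}) R[I/z_{ι i}]` iff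
  `a ∈ I` for constants; so `z_{ι i} ∤ z_k` for `k` off the centre;
* `isRsopPart_mk_comp_centre`, `isRegularRing_chart_quotient_zk` — modulo a further member
  `z_k` the chart ring is the chart ring of the regular local ring `R/(z_k)`
  (`blowupAlgebra.quotientKerMapQuotientEquiv`), hence a regular ring;
* `mul_algebraMap_notMem_sq` — **`w · z_k ∉ Q²` for `w ∉ Q ∋ z_k`** (`Q` a prime of the chart
  ring): the coefficient-free substitute for the derivation `∂/∂t_k` of the printed Jacobian
  argument (a regular ring modulo a non-zero element of `Q⁽²⁾` would be singular at `Q`).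

## Sources

* A. J. de Jong, *Smoothness, semi-stability and alterations*, Publ. Math. IHÉS 83 (1996), 4.27,
  pp. 75–76. [DeJong1996]
* A. J. de Jong, *Families of curves and alterations*, Ann. Inst. Fourier 47 (1997), proof of
  Prop. 5.11, p. 619. [DeJong1997]
* H. Matsumura, *Commutative Ring Theory* (1986), Thms. 14.2, 14.3, 16.2, 19.3. [Matsumura1987]
* Q. Liu, *Algebraic Geometry and Arithmetic Curves* (2002), Thm. 8.1.19 (a). [Liu2002]
* The Stacks Project, Tag 0BIQ. [StacksProject]
-/

set_option linter.dupNamespace false -- the tree's summit namespace repeats `ResolutionOfSingularities`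

noncomputable section

open IsLocalRing

namespace Summit.ResolutionOfSingularities.ResolutionOfSingularities.Theorems

open Literature.AlgebraicGeometry.Resolution

/-! ## Parts of regular systems of parameters pass to the quotient by their first member -/

/-- **A part of a regular system of parameters modulo its first member**: if
`(a, v₁, …, v_n)` is part of a regular system of parameters of `R`, then the classes of
`v₁, …, v_n` form part of a regular system of parameters of `R/(a)` (Matsumura 14.2: the
quotient `R/(a, v₁, …, v_n)` is regular of dimension `dim R - n - 1 = dim R/(a) - n`).
[cite: Matsumura1987, Thm. 14.2] -/
theorem isRsopPart_quotient_cons {R : Type} [CommRing R] [IsLocalRing R] {n : ℕ} {a : R}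
    {v : Fin n → R} (hw : IsRsopPart (Fin.cons a v : Fin (n + 1) → R))
    [IsLocalRing (R ⧸ Ideal.span {a})] :
    IsRsopPart (Ideal.Quotient.mk (Ideal.span {a}) ∘ v) := by
  haveI := hw.isRegularLocalRing
  haveI : IsLocalHom (Ideal.Quotient.mk (Ideal.span {a})) :=
    IsLocalHom.of_surjective _ Ideal.Quotient.mk_surjective
  rw [isRsopPart_iff_quotient]
  -- `(R/(a))/(v̄₁, …, v̄_n) ≅ R/(a, v₁, …, v_n)`
  have hJ : Ideal.span (Set.range (Ideal.Quotient.mk (Ideal.span {a}) ∘ v)) =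
      (Ideal.span (Set.range v)).map (Ideal.Quotient.mk (Ideal.span {a})) := by
    rw [Ideal.map_span, ← Set.range_comp]
  have hsup : Ideal.span {a} ⊔ Ideal.span (Set.range v) =
      Ideal.span (Set.range (Fin.cons a v : Fin (n + 1) → R)) := by
    rw [← Ideal.span_insert, ← Fin.range_cons]
  let e : ((R ⧸ Ideal.span {a}) ⧸ Ideal.span (Set.range (Ideal.Quotient.mk (Ideal.span {a}) ∘ v))) ≃+*
        R ⧸ Ideal.span (Set.range (Fin.cons a v : Fin (n + 1) → R)) :=
    (Ideal.quotEquivOfEq hJ).trans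
      ((DoubleQuot.quotQuotEquivQuotSup (Ideal.span {a}) _).trans (Ideal.quotEquivOfEq hsup))
  haveI hregw := hw.isRegularLocalRing_quotient
  refine ⟨fun j => ?_, IsRegularLocalRing.of_ringEquiv e.symm, ?_⟩
  · have h := hw.mem_maximalIdeal j.succ
    rw [Fin.cons_succ] at h
    exact (map_mem_nonunits_iff (Ideal.Quotient.mk (Ideal.span {a})) (v j)).mpr h
  · -- dimensions: `dim R/(a, v) + (n + 1) = dim R = dim R/(a) + 1`
    have h1 := hw.ringKrullDim_quotient_add
    have h0 : IsRsopPart (fun _ : Fin 1 => a) := by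
      have := hw.comp (fun _ : Fin 1 => (0 : Fin (n + 1))) (fun a b _ => Subsingleton.elim a b)
      simpa only [Function.comp_def, Fin.cons_zero] using this
    have h2 := h0.ringKrullDim_quotient_add
    have hr : Set.range (fun _ : Fin 1 => a) = {a} := by
      ext b
      simp only [Set.mem_range, exists_const, Set.mem_singleton_iff]
      exact eq_comm
    rw [hr] at h2
    rw [ringKrullDim_eq_of_ringEquiv e]
    obtain ⟨D, hD⟩ := exists_nat_cast_eq_ringKrullDim (R := R)
    obtain ⟨d, hd⟩ := exists_nat_cast_eq_ringKrullDim
      (R := R ⧸ Ideal.span (Set.range (Fin.cons a v : Fin (n + 1) → R)))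
    obtain ⟨d1, hd1⟩ := exists_nat_cast_eq_ringKrullDim (R := R ⧸ Ideal.span {a})
    rw [hD, hd] at h1
    rw [hD, hd1] at h2
    rw [hd, hd1]
    have e1 : d + (n + 1) = D := by exact_mod_cast h1
    have e2 : d1 + 1 = D := by exact_mod_cast h2
    have : d + n = d1 := by omega
    exact_mod_cast this

/-! ## The chart data: four members `z ∘ ι` of a part `z` of a regular system of parameters -/

section Charts

variable {R : Type} [CommRing R] [IsLocalRing R] {N : ℕ} {z : Fin N → R} (hz : IsRsopPart z)
  {ι : Fin 4 → Fin N} (hι : Function.Injective ι)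

include hz hι

/-- The centre `(z_{ι 0}, …, z_{ι 3})` is part of a regular system of parameters. [folklore] -/
theorem isRsopPart_comp_centre : IsRsopPart (z ∘ ι) :=
  hz.comp ι hι

/-- The centre is a quasi-regular sequence. [cite: Matsumura1987, Thm. 16.2 (i)] -/
theorem isQuasiRegular_comp_centre : IsQuasiRegular (z ∘ ι) :=
  (hz.comp ι hι).isQuasiRegular

/-- `R/(z ∘ ι)` is a regular local ring. [cite: Matsumura1987, Thm. 14.2] -/
theorem isRegularLocalRing_quot_comp_centre :
    IsRegularLocalRing (R ⧸ Ideal.span (Set.range (z ∘ ι))) :=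
  (hz.comp ι hι).isRegularLocalRing_quotient

/-- `R/(z ∘ ι)` is a regular ring. [cite: Matsumura1987, Thm. 19.3] -/
theorem isRegularRing_quot_comp_centre : IsRegularRing (R ⧸ Ideal.span (Set.range (z ∘ ι))) :=
  haveI := isRegularLocalRing_quot_comp_centre hz hι
  isRegularRing_of_isRegularLocalRing _

/-- `R/(z ∘ ι)` is a domain. [cite: Matsumura1987, Thm. 14.3] -/
theorem isDomain_quot_comp_centre : IsDomain (R ⧸ Ideal.span (Set.range (z ∘ ι))) :=
  haveI := isRegularLocalRing_quot_comp_centre hz hι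
  isDomain_of_isRegularLocalRing _

omit hι in
/-- `R` is a regular ring. [cite: Matsumura1987, Thm. 19.3] -/
theorem isRegularRing_base : IsRegularRing R :=
  haveI := hz.isRegularLocalRing
  isRegularRing_of_isRegularLocalRing _

omit hι in
/-- `R` is a domain. [cite: Matsumura1987, Thm. 14.3] -/
theorem isDomain_base : IsDomain R :=
  haveI := hz.isRegularLocalRing
  isDomain_of_isRegularLocalRing _

/-- **The chart ring `R[I/z_{ι i}]` is a regular ring** (Liu 8.1.19 (a) on the charts).
[cite: Liu2002, Thm. 8.1.19 (a)] -/
theorem isRegularRing_chart (i : Fin 4) :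
    IsRegularRing (blowupAlgebra (Ideal.span (Set.range (z ∘ ι))) ((z ∘ ι) i)) :=
  haveI := isRegularRing_base hz
  haveI := isRegularRing_quot_comp_centre hz hι
  blowupAlgebra.isRegularRing (z ∘ ι) i (isQuasiRegular_comp_centre hz hι)

omit hι in
/-- The members of the centre are non-zero. [folklore] -/
theorem comp_centre_ne_zero (i : Fin 4) : (z ∘ ι) i ≠ 0 :=
  hz.ne_zero (ι i)

omit hι in
/-- `R[1/z_{ι i}]` is a domain. [folklore] -/
theorem isDomain_away (i : Fin 4) : IsDomain (Localization.Away ((z ∘ ι) i)) :=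
  haveI := isDomain_base hz
  IsLocalization.isDomain_localization
    (powers_le_nonZeroDivisors_of_noZeroDivisors (comp_centre_ne_zero hz i))

omit hι in
/-- The chart ring `R[I/z_{ι i}] ⊆ R[1/z_{ι i}]` is a domain. [folklore] -/
theorem isDomain_chart (i : Fin 4) :
    IsDomain (blowupAlgebra (Ideal.span (Set.range (z ∘ ι))) ((z ∘ ι) i)) := by
  haveI : IsDomain (Localization.Away ((z ∘ ι) i)) := isDomain_away hz i
  infer_instance

omit hι in
/-- `R → R[I/z_{ι i}]` is injective. [folklore] -/
theorem algebraMap_chart_injective (i : Fin 4) :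
    Function.Injective (algebraMap R (blowupAlgebra (Ideal.span (Set.range (z ∘ ι))) ((z ∘ ι) i))) := by
  haveI := isDomain_base hz
  intro a b hab
  have h := congrArg Subtype.val hab
  change algebraMap R (Localization.Away ((z ∘ ι) i)) a = algebraMap R (Localization.Away ((z ∘ ι) i)) b at h
  exact IsLocalization.injective (M := Submonoid.powers ((z ∘ ι) i)) (Localization.Away ((z ∘ ι) i))
    (powers_le_nonZeroDivisors_of_noZeroDivisors (comp_centre_ne_zero hz i)) h

omit hι in
/-- Non-zero elements of `R` stay non-zero in the chart ring. [folklore] -/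
theorem algebraMap_chart_ne_zero (i : Fin 4) {a : R} (ha : a ≠ 0) :
    algebraMap R (blowupAlgebra (Ideal.span (Set.range (z ∘ ι))) ((z ∘ ι) i)) a ≠ 0 := by
  rw [Ne, ← map_zero (algebraMap R (blowupAlgebra (Ideal.span (Set.range (z ∘ ι))) ((z ∘ ι) i)))]
  exact fun h => ha (algebraMap_chart_injective hz i h)

/-- **The exceptional equation `z_{ι i}` is a prime element of the chart ring** (the exceptional
divisor of the chart is `Spec (R/I)[T]`, a domain). [cite: StacksProject, Tag 0BIQ] -/
theorem prime_algebraMap_centre (i : Fin 4) :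
    Prime (algebraMap R (blowupAlgebra (Ideal.span (Set.range (z ∘ ι))) ((z ∘ ι) i)) ((z ∘ ι) i)) := by
  haveI := isDomain_quot_comp_centre hz hι
  have hp := blowupAlgebra.isPrime_span_algebraMap (z ∘ ι) i (isQuasiRegular_comp_centre hz hι)
  exact (Ideal.span_singleton_prime (algebraMap_chart_ne_zero hz i (comp_centre_ne_zero hz i))).mp hp

omit hι in
/-- A member `z_k` of the system off the centre does not lie in the centre ideal. [folklore] -/
theorem notMem_span_comp_centre {k : Fin N} (hk : k ∉ Set.range ι) :
    z k ∉ Ideal.span (Set.range (z ∘ ι)) := by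
  rw [Set.range_comp]
  exact hz.not_mem_span_image hk

/-- **Membership in the exceptional ideal of constants**: `a ∈ (z_{ι i}) R[I/z_{ι i}]` iff
`a ∈ I`, for `a ∈ R`. [cite: StacksProject, Tag 0BIQ] -/
theorem algebraMap_mem_span_centre_iff (i : Fin 4) (a : R) :
    algebraMap R (blowupAlgebra (Ideal.span (Set.range (z ∘ ι))) ((z ∘ ι) i)) a ∈
      Ideal.span {algebraMap R (blowupAlgebra (Ideal.span (Set.range (z ∘ ι))) ((z ∘ ι) i)) ((z ∘ ι) i)} ↔
      a ∈ Ideal.span (Set.range (z ∘ ι)) := by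
  rw [← blowupAlgebra.eval_C (z ∘ ι) i a, blowupAlgebra.eval_mem_span_algebraMap_iff' (z ∘ ι) i
    (isQuasiRegular_comp_centre hz hι), MvPolynomial.mem_map_C_iff]
  constructor
  · intro h
    have h0 := h 0
    rwa [MvPolynomial.coeff_zero_C] at h0
  · intro h m
    rw [MvPolynomial.coeff_C]
    split_ifs
    · exact h
    · exact Ideal.zero_mem _

/-- **`z_k ∉ (z_{ι i}) R[I/z_{ι i}]`** for `k` off the centre. [cite: StacksProject, Tag 0BIQ] -/
theorem algebraMap_notMem_span_centre (i : Fin 4) {k : Fin N} (hk : k ∉ Set.range ι) :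
    algebraMap R (blowupAlgebra (Ideal.span (Set.range (z ∘ ι))) ((z ∘ ι) i)) (z k) ∉
      Ideal.span {algebraMap R (blowupAlgebra (Ideal.span (Set.range (z ∘ ι))) ((z ∘ ι) i)) ((z ∘ ι) i)} := by
  rw [algebraMap_mem_span_centre_iff hz hι]
  exact notMem_span_comp_centre hz hk

/-- `z_{ι i} ∤ z_k` in the chart ring, for `k` off the centre. [folklore] -/
theorem not_dvd_algebraMap (i : Fin 4) {k : Fin N} (hk : k ∉ Set.range ι) :
    ¬ algebraMap R (blowupAlgebra (Ideal.span (Set.range (z ∘ ι))) ((z ∘ ι) i)) ((z ∘ ι) i) ∣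
      algebraMap R (blowupAlgebra (Ideal.span (Set.range (z ∘ ι))) ((z ∘ ι) i)) (z k) := fun h =>
  algebraMap_notMem_span_centre hz hι i hk (Ideal.mem_span_singleton.mpr h)

/-! ## The chart ring modulo a further member `z_k`: the chart ring of `R/(z_k)` -/

omit hι in
/-- `R/(z_k)` is a regular local ring. [cite: Matsumura1987, Thm. 14.2] -/
theorem isRegularLocalRing_quot_zk (k : Fin N) : IsRegularLocalRing (R ⧸ Ideal.span {z k}) := by
  have h0 : IsRsopPart (fun _ : Fin 1 => z k) :=
    hz.comp (fun _ => k) (fun a b _ => Subsingleton.elim a b)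
  have hr : Set.range (fun _ : Fin 1 => z k) = {z k} := by
    ext a
    simp only [Set.mem_range, exists_const, Set.mem_singleton_iff]
    exact eq_comm
  have := h0.isRegularLocalRing_quotient
  rwa [hr] at this

/-- **The centre stays part of a regular system of parameters modulo `z_k`** (`k` off the
centre). [cite: Matsumura1987, Thm. 14.2] -/
theorem isRsopPart_mk_comp_centre {k : Fin N} (hk : k ∉ Set.range ι) :
    haveI := isRegularLocalRing_quot_zk hz k
    IsRsopPart (Ideal.Quotient.mk (Ideal.span {z k}) ∘ (z ∘ ι)) := by
  haveI := isRegularLocalRing_quot_zk hz k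
  have hκ : Function.Injective (Fin.cons k ι : Fin 5 → Fin N) := Fin.cons_injective_iff.mpr ⟨hk, hι⟩
  have hw : IsRsopPart (z ∘ Fin.cons k ι) := hz.comp _ hκ
  rw [Fin.comp_cons] at hw
  exact isRsopPart_quotient_cons hw

omit [IsLocalRing R] hz hι in
/-- The centre ideal modulo `z_k` is generated by the classes of the centre. [folklore] -/
theorem map_mk_span_comp_centre (k : Fin N) :
    (Ideal.span (Set.range (z ∘ ι))).map (Ideal.Quotient.mk (Ideal.span {z k})) =
      Ideal.span (Set.range (Ideal.Quotient.mk (Ideal.span {z k}) ∘ (z ∘ ι))) := by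
  rw [Ideal.map_span, ← Set.range_comp]

/-- **The chart ring of `R/(z_k)` along the image centre is a regular ring** (`k` off the
centre): `R/(z_k)` is regular local and the image centre is again part of a regular system of
parameters. [cite: Liu2002, Thm. 8.1.19 (a)] -/
theorem isRegularRing_chart_quot_zk (i : Fin 4) {k : Fin N} (hk : k ∉ Set.range ι) :
    IsRegularRing (blowupAlgebra ((Ideal.span (Set.range (z ∘ ι))).map
      (Ideal.Quotient.mk (Ideal.span {z k}))) (Ideal.Quotient.mk (Ideal.span {z k}) ((z ∘ ι) i))) := by
  haveI := isRegularLocalRing_quot_zk hz k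
  have h := isRsopPart_mk_comp_centre hz hι hk
  haveI : IsRegularRing (R ⧸ Ideal.span {z k}) := isRegularRing_of_isRegularLocalRing _
  haveI : IsRegularRing ((R ⧸ Ideal.span {z k}) ⧸
      Ideal.span (Set.range (Ideal.Quotient.mk (Ideal.span {z k}) ∘ (z ∘ ι)))) :=
    haveI := h.isRegularLocalRing_quotient
    isRegularRing_of_isRegularLocalRing _
  rw [map_mk_span_comp_centre]
  exact blowupAlgebra.isRegularRing (Ideal.Quotient.mk (Ideal.span {z k}) ∘ (z ∘ ι)) i h.isQuasiRegular

/-- **The chart ring modulo `z_k` is a regular ring** (`k` off the centre): it is the chart ring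
of `R/(z_k)` (`blowupAlgebra.quotientKerMapQuotientEquiv`: the `z_{ι i}`-saturation of
`(z_k)` is `(z_k)`, as `z_{ι i}` is prime and does not divide `z_k`).
[cite: GortzWedhorn2020, Prop. 13.96 (2) and p. 416] -/
theorem isRegularRing_chart_quotient_zk (i : Fin 4) {k : Fin N} (hk : k ∉ Set.range ι) :
    IsRegularRing (blowupAlgebra (Ideal.span (Set.range (z ∘ ι))) ((z ∘ ι) i) ⧸
      Ideal.span {algebraMap R (blowupAlgebra (Ideal.span (Set.range (z ∘ ι))) ((z ∘ ι) i)) (z k)}) := by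
  haveI := isRegularRing_chart_quot_zk hz hι i hk
  have hf : algebraMap R (blowupAlgebra (Ideal.span (Set.range (z ∘ ι))) ((z ∘ ι) i)) (z k) =
      algebraMap R (blowupAlgebra (Ideal.span (Set.range (z ∘ ι))) ((z ∘ ι) i)) ((z ∘ ι) i) ^ 0 *
        algebraMap R (blowupAlgebra (Ideal.span (Set.range (z ∘ ι))) ((z ∘ ι) i)) (z k) := by
    rw [pow_zero, one_mul]
  exact IsRegularRing.of_ringEquiv (blowupAlgebra.quotientKerMapQuotientEquiv
    (Ideal.span (Set.range (z ∘ ι))) ((z ∘ ι) i) hf (prime_algebraMap_centre hz hι i)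
    (not_dvd_algebraMap hz hι i hk)).symm

end Charts

/-! ## The key estimate: `w · z_k ∉ Q²` -/

/-- **`w · z_k ∉ Q²` for `w ∉ Q`, `z_k ∈ Q`** (`Q` a prime of the chart ring, `k` off the
centre): otherwise the regular ring `R[I/z_{ι i}]/(z_k)` would be singular at `Q/(z_k)`
(a hypersurface `z_k ∈ Q²` locally). [cite: Matsumura1987, Thm. 14.2] -/
theorem mul_algebraMap_notMem_sq {R : Type} [CommRing R] [IsLocalRing R] {N : ℕ} {z : Fin N → R}
    (hz : IsRsopPart z) {ι : Fin 4 → Fin N} (hι : Function.Injective ι) (i : Fin 4) {k : Fin N} (hk : k ∉ Set.range ι)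
    (Q : Ideal (blowupAlgebra (Ideal.span (Set.range (z ∘ ι))) ((z ∘ ι) i))) [Q.IsPrime]
    (hkQ : algebraMap R (blowupAlgebra (Ideal.span (Set.range (z ∘ ι))) ((z ∘ ι) i)) (z k) ∈ Q)
    {w : blowupAlgebra (Ideal.span (Set.range (z ∘ ι))) ((z ∘ ι) i)} (hw : w ∉ Q) :
    w * algebraMap R (blowupAlgebra (Ideal.span (Set.range (z ∘ ι))) ((z ∘ ι) i)) (z k) ∉ Q ^ 2 := by
  -- adapted from `mul_C_notMem_sq` (…OrbitNormalFormBlowupModelSing2.lean)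
  intro hwa
  haveI := isRegularRing_chart hz hι i
  haveI := isDomain_chart hz (ι := ι) i
  have hf0 : algebraMap R (blowupAlgebra (Ideal.span (Set.range (z ∘ ι))) ((z ∘ ι) i)) (z k) ≠ 0 :=
    algebraMap_chart_ne_zero hz i (hz.ne_zero k)
  have hIQ : Ideal.span {algebraMap R (blowupAlgebra (Ideal.span (Set.range (z ∘ ι))) ((z ∘ ι) i)) (z k)}
      ≤ Q := by
    rw [Ideal.span_le, Set.singleton_subset_iff]
    exact hkQ
  have hker : RingHom.ker (Ideal.Quotient.mk (Ideal.span {algebraMap R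
      (blowupAlgebra (Ideal.span (Set.range (z ∘ ι))) ((z ∘ ι) i)) (z k)})) ≤ Q := by
    rw [Ideal.mk_ker]
    exact hIQ
  haveI hPp : (Q.map (Ideal.Quotient.mk (Ideal.span {algebraMap R
      (blowupAlgebra (Ideal.span (Set.range (z ∘ ι))) ((z ∘ ι) i)) (z k)}))).IsPrime :=
    Ideal.map_isPrime_of_surjective Ideal.Quotient.mk_surjective hker
  have hPQ : (Q.map (Ideal.Quotient.mk (Ideal.span {algebraMap R
      (blowupAlgebra (Ideal.span (Set.range (z ∘ ι))) ((z ∘ ι) i)) (z k)}))).comap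
      (Ideal.Quotient.mk (Ideal.span {algebraMap R
        (blowupAlgebra (Ideal.span (Set.range (z ∘ ι))) ((z ∘ ι) i)) (z k)})) = Q := by
    rw [Ideal.comap_map_of_surjective _ Ideal.Quotient.mk_surjective,
      ← RingHom.ker_eq_comap_bot, Ideal.mk_ker]
    exact le_antisymm (sup_le le_rfl hIQ) le_sup_left
  haveI := isRegularRing_chart_quotient_zk hz hι i hk
  refine not_isRegularLocalRing_localization_quotient_of_mul_mem_sq hf0
    (Q.map (Ideal.Quotient.mk (Ideal.span {algebraMap R
      (blowupAlgebra (Ideal.span (Set.range (z ∘ ι))) ((z ∘ ι) i)) (z k)})))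
    (w := w) (by rw [hPQ]; exact hw) (by rw [hPQ]; exact hwa) ?_
  exact IsRegularRing.isRegularLocalRing_localization _


end Summit.ResolutionOfSingularities.ResolutionOfSingularities.Theorems

end
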